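import Summits.MatrixMultiplication.OmegaCensus.PhaseArcPatterns

/-!
# ω-census, family (b3): conjecture C9 on the Frobenius family — counting phase-arc cells (explicit arcs inside the trimmed blocks)

HONEST FRAMING (pub-omega census; verbatim): lottery ticket; floor = certified bounds/negative ranges.
Census BOOKKEEPING (conjecture C9 of the cell; pub-omega stpp-1 gen 20).  Layer 3 of the seat's uniform construction for
`ℤ/p ⋊_u ℤ/3` (design note HOME/pub-omega-stpp-1-g20/UNIFORM-FROBENIUS-DESIGN.md).  `PhaseArcPatterns.lean` proves that the
phase-arc cell set `phaseCells p P lo hi` (unions of trimmed phase blocks) is an independent pattern under a finite condition; to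
USE it in `ABox.not_boxUseful_of_pattern` one needs `9p ≤ 5·#cells`, i.e. a COUNT that is linear arithmetic in `p` and the trims.
This file provides: `PatIndep` is hereditary (`MetaCyc.ABox.PatIndep.anti`); the explicit ARC SET `arcSet p P lo hi` — for each
column `c` and phase `φ ∈ P c` the coordinates `A = n (mod p)`, `n ∈ [⌈(φp + lo)/8⌉, ⌊((φ+1)p − hi − 1)/8⌋]` — is contained in
`phaseCells p P lo hi` (`arcSet_subset_phaseCells`) and has EXACTLY `Σ_c Σ_{φ ∈ P c} #[start, stop]` elements (`card_arcSet`),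
each arc having `#Icc = (stop + 1 − start).toNat` coordinates with `8·(stop + 1 − start) ≥ p − lo − hi − 15` (`eight_mul_arcLen_ge`).  Hypotheses: phases in `[0, 8)`, trims `≥ 0`.  Nothing here is progress on `ω`.
-/

namespace Summit.MatrixMultiplication.OmegaCensus

open Finset

namespace MetaCyc.ABox

/-- Pattern independence is hereditary. [folklore] -/
theorem PatIndep.anti {N q : ℕ} {u : ZMod N} {D : MetaCyc.ABox N q} {T T' : Finset ((Fin 3 × Fin 3) × ZMod N)}
    (h : T' ⊆ T) (hT : D.PatIndep u T) : D.PatIndep u T' :=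
  fun x hx y hy hxy => hT x (h hx) y (h hy) hxy

end MetaCyc.ABox

namespace PhaseArcs

variable {p : ℕ}

/-- First coordinate of the arc of phase `φ` in column `c`: `⌈(φ p + lo)/8⌉`. [folklore] -/
noncomputable def arcStart (p : ℕ) (lo : Fin 3 × Fin 3 → ℤ → ℤ) (c : Fin 3 × Fin 3) (φ : ℤ) : ℤ := (φ * p + lo c φ + 7) / 8

/-- Last coordinate of the arc of phase `φ` in column `c`: `⌊((φ+1) p − hi − 1)/8⌋`. [folklore] -/
noncomputable def arcStop (p : ℕ) (hi : Fin 3 × Fin 3 → ℤ → ℤ) (c : Fin 3 × Fin 3) (φ : ℤ) : ℤ := ((φ + 1) * p - hi c φ - 1) / 8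

/-- The explicit arc set: column `c`, phase `φ ∈ P c`, coordinates `n (mod p)` for `n ∈ [arcStart, arcStop]`. [folklore] -/
noncomputable def arcSet (p : ℕ) [NeZero p] (P : Fin 3 × Fin 3 → Finset ℤ) (lo hi : Fin 3 × Fin 3 → ℤ → ℤ) :
    Finset ((Fin 3 × Fin 3) × ZMod p) :=
  (univ : Finset (Fin 3 × Fin 3)).biUnion fun c => (P c).biUnion fun φ =>
    (Icc (arcStart p lo c φ) (arcStop p hi c φ)).image fun n : ℤ => (c, (n : ZMod p))

/-- Bounds of an arc coordinate: `0 ≤ n < p` and the trimmed block inequalities for `8n`. [folklore] -/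
theorem arc_bounds {P : Fin 3 × Fin 3 → Finset ℤ} {lo hi : Fin 3 × Fin 3 → ℤ → ℤ}
    (hP : ∀ c, ∀ φ ∈ P c, 0 ≤ φ ∧ φ < 8) (hlo : ∀ c, ∀ φ ∈ P c, 0 ≤ lo c φ) (hhi : ∀ c, ∀ φ ∈ P c, 0 ≤ hi c φ)
    {c : Fin 3 × Fin 3} {φ : ℤ} (hφ : φ ∈ P c) {n : ℤ} (hn : n ∈ Icc (arcStart p lo c φ) (arcStop p hi c φ)) :
    0 ≤ n ∧ n < p ∧ φ * p + lo c φ ≤ 8 * n ∧ 8 * n + hi c φ < (φ + 1) * p := by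
  rw [mem_Icc, arcStart, arcStop] at hn
  obtain ⟨h1, h2⟩ := hn
  obtain ⟨hφ0, hφ8⟩ := hP c φ hφ
  have hl := hlo c φ hφ
  have hh := hhi c φ hφ
  have hp0 : (0 : ℤ) ≤ p := by positivity
  refine ⟨?_, ?_, ?_, ?_⟩
  · have : 0 ≤ φ * ↑p := mul_nonneg hφ0 hp0
    omega
  · have : (φ + 1) * ↑p ≤ 8 * ↑p := by nlinarith
    omega
  · omega
  · omega

/-- The value of an arc coordinate cast to `ZMod p` is the coordinate itself. [folklore] -/
theorem val_cast_of_bounds [NeZero p] {n : ℤ} (h0 : 0 ≤ n) (hp : n < p) : (((n : ZMod p)).val : ℤ) = n := by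
  rw [ZMod.val_intCast, Int.emod_eq_of_lt h0 hp]

/-- **The arc set lies in the phase-arc cell set.** [folklore] -/
theorem arcSet_subset_phaseCells [NeZero p] {P : Fin 3 × Fin 3 → Finset ℤ} {lo hi : Fin 3 × Fin 3 → ℤ → ℤ}
    (hP : ∀ c, ∀ φ ∈ P c, 0 ≤ φ ∧ φ < 8) (hlo : ∀ c, ∀ φ ∈ P c, 0 ≤ lo c φ) (hhi : ∀ c, ∀ φ ∈ P c, 0 ≤ hi c φ) :
    arcSet p P lo hi ⊆ phaseCells p P lo hi := by
  intro x hx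
  simp only [arcSet, mem_biUnion, mem_univ, true_and, mem_image] at hx
  obtain ⟨c, φ, hφ, n, hn, rfl⟩ := hx
  obtain ⟨h0, hp, h1, h2⟩ := arc_bounds hP hlo hhi hφ hn
  rw [mem_phaseCells]
  exact ⟨φ, hφ, by rw [val_cast_of_bounds h0 hp]; exact h1, by rw [val_cast_of_bounds h0 hp]; exact h2⟩

/-- **Exact count of the arc set**: the arcs are pairwise disjoint and each has `#Icc` coordinates. [folklore] -/
theorem card_arcSet [NeZero p] {P : Fin 3 × Fin 3 → Finset ℤ} {lo hi : Fin 3 × Fin 3 → ℤ → ℤ}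
    (hP : ∀ c, ∀ φ ∈ P c, 0 ≤ φ ∧ φ < 8) (hlo : ∀ c, ∀ φ ∈ P c, 0 ≤ lo c φ) (hhi : ∀ c, ∀ φ ∈ P c, 0 ≤ hi c φ) :
    #(arcSet p P lo hi) = ∑ c, ∑ φ ∈ P c, (arcStop p hi c φ + 1 - arcStart p lo c φ).toNat := by
  -- injectivity of `n ↦ (c, n mod p)` on an arc
  have hinj : ∀ c, ∀ φ ∈ P c, Set.InjOn (fun n : ℤ => (c, (n : ZMod p)))
      (Icc (arcStart p lo c φ) (arcStop p hi c φ) : Set ℤ) := by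
    intro c φ hφ n hn n' hn' e
    simp only [Prod.mk.injEq, true_and] at e
    have hb := arc_bounds hP hlo hhi hφ (mem_coe.1 hn)
    have hb' := arc_bounds hP hlo hhi hφ (mem_coe.1 hn')
    have := congrArg (fun z : ZMod p => (z.val : ℤ)) e
    simp only [val_cast_of_bounds hb.1 hb.2.1, val_cast_of_bounds hb'.1 hb'.2.1] at this
    exact this
  rw [arcSet, card_biUnion]
  · refine sum_congr rfl fun c _ => ?_
    rw [card_biUnion]
    · refine sum_congr rfl fun φ hφ => ?_
      rw [card_image_of_injOn (hinj c φ hφ), Int.card_Icc]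
    · -- arcs of distinct phases in one column are disjoint
      intro φ hφ φ' hφ' hne
      rw [Function.onFun, disjoint_left]
      intro x hx hx'
      rw [mem_image] at hx hx'
      obtain ⟨n, hn, rfl⟩ := hx
      obtain ⟨n', hn', e⟩ := hx'
      simp only [Prod.mk.injEq, true_and] at e
      have hb := arc_bounds hP hlo hhi hφ hn
      have hb' := arc_bounds hP hlo hhi hφ' hn'
      have := congrArg (fun z : ZMod p => (z.val : ℤ)) e
      simp only [val_cast_of_bounds hb.1 hb.2.1, val_cast_of_bounds hb'.1 hb'.2.1] at this
      subst this
      -- `8 n'` lies in block `φ'` and in block `φ`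
      have hl := hlo c φ hφ; have hh := hhi c φ hφ; have hl' := hlo c φ' hφ'; have hh' := hhi c φ' hφ'
      have hp0 : (0 : ℤ) < p := by have := NeZero.pos p; exact_mod_cast this
      rcases lt_or_gt_of_ne hne with hlt | hlt
      · have : (φ + 1) * (p : ℤ) ≤ φ' * p := by nlinarith
        omega
      · have : (φ' + 1) * (p : ℤ) ≤ φ * p := by nlinarith
        omega
  · -- different columns give disjoint sets
    intro c _ c' _ hne
    rw [Function.onFun, disjoint_left]
    intro x hx hx'
    simp only [mem_biUnion, mem_image] at hx hx'
    obtain ⟨φ, -, n, -, rfl⟩ := hx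
    obtain ⟨φ', -, n', -, e⟩ := hx'
    simp only [Prod.mk.injEq] at e
    exact hne e.1.symm

/-- Each arc is long: `8·#arc ≥ p − lo − hi − 15` (as an inequality of integers). [folklore] -/
theorem eight_mul_arcLen_ge {lo hi : Fin 3 × Fin 3 → ℤ → ℤ} (c : Fin 3 × Fin 3) (φ : ℤ) :
    (p : ℤ) - lo c φ - hi c φ - 15 ≤ 8 * (arcStop p hi c φ + 1 - arcStart p lo c φ) := by
  simp only [arcStart, arcStop]
  have : (φ + 1) * (p : ℤ) = φ * p + p := by ring
  omega

end PhaseArcs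

end Summit.MatrixMultiplication.OmegaCensus
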